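import Literature.Barriers.CriticalPhenomena.TimarCriticalNonunimodular
import Literature.Barriers.CriticalPhenomena.UnimodularSubgroup
import HarnessLib

/-!
# Timár 2006, §2 / proof of Cor. 5.7: the level-preserving automorphisms act on a finite union
# of levels quasi-transitively and unimodularly — PROVED, in the form the tree's facts consume

Barrier catalogue `Literature/Barriers/CriticalPhenomena/`; a brick of the programme behind the
heavy half of Timár's Cor. 5.7 (`Timar2006_notInfinitelyManyHeavyCriticalClusters`,
`TimarCriticalNonunimodular.lean`). Timár (Ann. Probab. 34 (2006), §2, p. 2347 of the journal /
p. 4 of arXiv:math/0702875): "Note that if we take a finite set of levels in a transitive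
nonunimodular graph `G` and restrict `Aut(G)` to the union of these levels [i.e., take the
subgroup of `Aut(G)` of elements that fix levels], it is quasi-transitive and unimodular"; proof
of Cor. 5.7: "the percolation restricted to some union `L` of finitely many levels would also have
infinitely many infinite clusters. However, the action of `Aut(G)` on `L` is quasi-transitive and
unimodular, in which case it is known [BLPS 1999] …". The catalogue's uniqueness facts
(`BenjaminiLyonsPeresSchramm1999_numCriticalClusters_ne_top`, `BurtonKeane1989_atMostOneInfiniteCluster`)
are stated for CONNECTED graphs and for the FULL automorphism group (`IsQuasiTransitive`,
`IsGraphUnimodular`). The induced graph on a finite union of levels is in general disconnected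
(grandmother graph: only finite components), so the objects to which those facts apply are the
connected COMPONENTS of the union, and the passage from Timár's subgroup to the full automorphism
group of a component is Lyons–Peres 2016, Exercise 8.8 (`UnimodularSubgroup.lean`). This file
proves, for `G` connected, locally finite and transitive (`IsGraphTransitive`), `S` a finite set
of vertices, `L = levelUnion G S` and `K = levelComponent G S y₀` the component of `y₀ ∈ L` in
the step graph `withinGraph G L`:

* level-preserving automorphisms (`autWeight`-preserving; one vertex suffices,
  `autWeight_map_eq_of_eq`) preserve `L`, act on `withinGraph G L`, and permute its components
  (`image_levelComponent`);
* `restrictIso` — the restriction of a `K`-preserving automorphism to the induced graph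
  `G.induce K`, and `restrictSubgroup G K o` — the subgroup of `Aut(G.induce K)` of restrictions
  of weight-preserving `K`-preserving automorphisms of `G` (Timár's "restrict `Aut(G)` to the
  union of these levels", cut down to one component);
* `levelComponent_connected`, `levelComponent_isQuasiTransitive`,
  `levelComponent_isGraphUnimodular` — **`G.induce K` is connected, quasi-transitive and
  unimodular** (full automorphism group): the `restrictSubgroup`-orbits are the traces of the
  levels (transitivity of `G`), its stabiliser orbits are the `S(x)y` of `G`
  (`image_val_sgStabilizerOrbit`), which have `|S(x)y| = |S(y)x|` on a level by the very
  definition of levels, and Exercise 8.8 lifts both properties to `Aut(G.induce K)`.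

Nonunimodularity of `G` is not needed for these statements.

## References

* Á. Timár, *Percolation on nonunimodular transitive graphs*, Ann. Probab. 34 (2006) 2344–2364,
  §2 (levels; the level-preserving subgroup is quasi-transitive and unimodular), proof of Cor. 5.7.
  [Timar2006]
* R. Lyons, Y. Peres, *Probability on Trees and Networks*, CUP 2016, §8.2, Exercise 8.8.
  [LyonsPeres2016]
-/

noncomputable section

namespace Literature.Barriers.CriticalPhenomena

open Literature.Probability.Percolation

variable {V : Type*}

/-! ### Level-preserving (= weight-preserving) automorphisms -/

/-- **An automorphism preserving the weight of one vertex preserves all weights** ("any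
automorphism of `G` acts on the weights of the levels by multiplying them with a constant",
Timár 2006, §5; `autWeight_map_mul`). [cite: Timar2006, §5 (automorphisms act on weights by a constant factor)] -/
theorem autWeight_map_eq_of_eq (G : SimpleGraph V) [G.LocallyFinite] (hconn : G.Connected)
    (γ : G ≃g G) (o : V) {x₀ : V} (h₀ : autWeight G o (γ x₀) = autWeight G o x₀) (x : V) :
    autWeight G o (γ x) = autWeight G o x := by
  have h := autWeight_map_mul G hconn γ o x x₀
  rw [h₀, mul_comm (autWeight G o x₀)] at h
  exact (ENNReal.mul_left_inj (autWeight_ne_zero G hconn o x₀) (autWeight_ne_top G hconn o x₀)).1 h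

/-- An automorphism mapping some vertex to a vertex of the same level preserves all weights.
[cite: Timar2006, §2 and §5 (levels = weight classes; automorphisms scale weights)] -/
theorem autWeight_map_eq_of_sameLevel (G : SimpleGraph V) [G.LocallyFinite] (hconn : G.Connected)
    (γ : G ≃g G) (o : V) {x₀ : V} (h₀ : SameLevel G x₀ (γ x₀)) (x : V) :
    autWeight G o (γ x) = autWeight G o x :=
  autWeight_map_eq_of_eq G hconn γ o ((sameLevel_iff_autWeight_eq G hconn o _ _).1 h₀).symm x

/-- A weight-preserving automorphism keeps every vertex on its level.
[cite: Timar2006, §2 (two vertices are on the same level iff their weights are the same)] -/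
theorem sameLevel_map_of_autWeight_map_eq (G : SimpleGraph V) [G.LocallyFinite]
    (hconn : G.Connected) {γ : G ≃g G} {o : V} (h : ∀ x, autWeight G o (γ x) = autWeight G o x)
    (x : V) : SameLevel G x (γ x) := by
  rw [sameLevel_iff_autWeight_eq G hconn o, h x]

/-- Weight-preserving automorphisms preserve finite unions of levels.
[cite: Timar2006, §2 (the subgroup of Aut(G) of elements that fix levels)] -/
theorem map_mem_levelUnion_iff (G : SimpleGraph V) [G.LocallyFinite] (hconn : G.Connected)
    {γ : G ≃g G} {o : V} (h : ∀ x, autWeight G o (γ x) = autWeight G o x) (S : Finset V) (v : V) :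
    γ v ∈ levelUnion G S ↔ v ∈ levelUnion G S := by
  have hv : SameLevel G v (γ v) := sameLevel_map_of_autWeight_map_eq G hconn h v
  rw [mem_levelUnion_iff, mem_levelUnion_iff]
  constructor
  · rintro ⟨s, hs, hsv⟩
    exact ⟨s, hs, hsv.trans hconn hv.symm⟩
  · rintro ⟨s, hs, hsv⟩
    exact ⟨s, hs, hsv.trans hconn hv⟩

/-- Weight-preserving automorphisms act on the step graph of a finite union of levels:
reachability in `withinGraph G (levelUnion G S)` is transported. [folklore] -/
theorem reachable_withinGraph_levelUnion_map (G : SimpleGraph V) [G.LocallyFinite]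
    (hconn : G.Connected) {γ : G ≃g G} {o : V} (h : ∀ x, autWeight G o (γ x) = autWeight G o x)
    (S : Finset V) {u v : V} (huv : (withinGraph G (levelUnion G S)).Reachable u v) :
    (withinGraph G (levelUnion G S)).Reachable (γ u) (γ v) := by
  obtain ⟨w⟩ := huv
  induction w with
  | nil => rfl
  | cons hadj _ ih =>
    refine SimpleGraph.Adj.reachable ?_ |>.trans ih
    rw [withinGraph_adj] at hadj ⊢
    exact ⟨(γ.map_rel_iff').2 hadj.1, (map_mem_levelUnion_iff G hconn h S _).2 hadj.2.1,
      (map_mem_levelUnion_iff G hconn h S _).2 hadj.2.2⟩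

/-! ### Components of a finite union of levels -/

/-- The **component of `y` in a finite union of levels**: the vertices joined to `y` by a path of
`G` all of whose steps stay inside `levelUnion G S` (the connected component of `y` in the
subgraph induced on the union of levels, Timár's "union `L` of finitely many levels", read
componentwise). [cite: Timar2006, §2 (union of levels) and proof of Cor. 5.7] -/
def levelComponent (G : SimpleGraph V) (S : Finset V) (y : V) : Set V :=
  {v | (withinGraph G (levelUnion G S)).Reachable y v}

/-- Membership in a level component is reachability in the step graph. [folklore] -/
theorem mem_levelComponent_iff {G : SimpleGraph V} {S : Finset V} {y v : V} :
    v ∈ levelComponent G S y ↔ (withinGraph G (levelUnion G S)).Reachable y v := Iff.rfl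

/-- `y` lies in its own level component. [folklore] -/
theorem mem_levelComponent_self (G : SimpleGraph V) (S : Finset V) (y : V) :
    y ∈ levelComponent G S y :=
  SimpleGraph.Reachable.refl y

/-- A vertex of the component of `y` has the same component. [folklore] -/
theorem levelComponent_eq_of_mem {G : SimpleGraph V} {S : Finset V} {y v : V}
    (hv : v ∈ levelComponent G S y) : levelComponent G S v = levelComponent G S y := by
  ext z
  rw [mem_levelComponent_iff, mem_levelComponent_iff]
  rw [mem_levelComponent_iff] at hv
  exact ⟨fun hz => hv.trans hz, fun hz => hv.symm.trans hz⟩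

/-- The component of a vertex of the union lies inside the union. [folklore] -/
theorem levelComponent_subset_levelUnion {G : SimpleGraph V} {S : Finset V} {y : V}
    (hy : y ∈ levelUnion G S) : levelComponent G S y ⊆ levelUnion G S := by
  intro v hv
  obtain ⟨w⟩ := hv
  induction w with
  | nil => exact hy
  | cons hadj _ ih => exact ih hadj.2.2

/-- Weight-preserving automorphisms permute the level components: `γ K(y) = K(γ y)`.
[folklore] -/
theorem image_levelComponent (G : SimpleGraph V) [G.LocallyFinite] (hconn : G.Connected)
    {γ : G ≃g G} {o : V} (h : ∀ x, autWeight G o (γ x) = autWeight G o x) (S : Finset V) (y : V) :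
    (γ : V → V) '' levelComponent G S y = levelComponent G S (γ y) := by
  have hsymm : ∀ x, autWeight G o (γ.symm x) = autWeight G o x := fun x => by
    have := h (γ.symm x)
    rw [γ.apply_symm_apply] at this
    exact this.symm
  ext z
  constructor
  · rintro ⟨v, hv, rfl⟩
    exact reachable_withinGraph_levelUnion_map G hconn h S hv
  · intro hz
    refine ⟨γ.symm z, ?_, γ.apply_symm_apply z⟩
    have := reachable_withinGraph_levelUnion_map G hconn hsymm S hz
    rw [γ.symm_apply_apply] at this
    exact this

/-- For a weight-preserving automorphism fixing (as a set) the component of `y₀`, membership in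
the component is invariant. [folklore] -/
theorem mem_levelComponent_map_iff (G : SimpleGraph V) [G.LocallyFinite] (hconn : G.Connected)
    {γ : G ≃g G} {o : V} (h : ∀ x, autWeight G o (γ x) = autWeight G o x) (S : Finset V) {y₀ : V}
    (hy₀ : γ y₀ ∈ levelComponent G S y₀) (v : V) :
    v ∈ levelComponent G S y₀ ↔ γ v ∈ levelComponent G S y₀ := by
  have hKeq : (γ : V → V) '' levelComponent G S y₀ = levelComponent G S y₀ := by
    rw [image_levelComponent G hconn h S y₀, levelComponent_eq_of_mem hy₀]
  constructor
  · intro hv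
    rw [← hKeq]
    exact ⟨v, hv, rfl⟩
  · intro hv
    rw [← hKeq] at hv
    obtain ⟨u, hu, huv⟩ := hv
    exact γ.injective huv ▸ hu

/-! ### Restriction of automorphisms to an invariant vertex set -/

/-- The restriction of an automorphism of `G` to the induced graph on an invariant vertex set
`K`. [folklore] -/
def restrictIso {G : SimpleGraph V} (γ : G ≃g G) (K : Set V) (hK : ∀ v, v ∈ K ↔ γ v ∈ K) :
    G.induce K ≃g G.induce K where
  toEquiv := γ.toEquiv.subtypeEquiv hK
  map_rel_iff' := by
    intro a b
    exact γ.map_rel_iff'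

/-- The restriction acts as `γ` on the underlying vertices. [folklore] -/
@[simp] theorem restrictIso_apply_coe {G : SimpleGraph V} (γ : G ≃g G) (K : Set V)
    (hK : ∀ v, v ∈ K ↔ γ v ∈ K) (a : K) : (restrictIso γ K hK a : V) = γ a := rfl

/-- The **restricted group**: the subgroup of `Aut(G.induce K)` consisting of the restrictions of
the automorphisms of `G` that preserve `K` and preserve the weights (equivalently, the levels;
Timár's "subgroup of `Aut(G)` of elements that fix levels", restricted to the invariant set `K`).
[cite: Timar2006, §2 (restrict Aut(G) to the union of these levels)] -/
def restrictSubgroup (G : SimpleGraph V) (K : Set V) (o : V) :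
    Subgroup (G.induce K ≃g G.induce K) where
  carrier := {φ | ∃ (γ : G ≃g G) (hK : ∀ v, v ∈ K ↔ γ v ∈ K),
    (∀ x, autWeight G o (γ x) = autWeight G o x) ∧ φ = restrictIso γ K hK}
  one_mem' := ⟨RelIso.refl _, fun _ => Iff.rfl, fun _ => rfl, RelIso.ext fun _ => Subtype.ext rfl⟩
  mul_mem' := by
    rintro φ₁ φ₂ ⟨γ₁, hK₁, hw₁, rfl⟩ ⟨γ₂, hK₂, hw₂, rfl⟩
    refine ⟨γ₂.trans γ₁, fun v => (hK₂ v).trans (hK₁ (γ₂ v)), fun x => ?_,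
      RelIso.ext fun _ => Subtype.ext rfl⟩
    show autWeight G o (γ₁ (γ₂ x)) = autWeight G o x
    rw [hw₁, hw₂]
  inv_mem' := by
    rintro φ ⟨γ, hK, hw, rfl⟩
    refine ⟨γ.symm, fun v => ?_, fun x => ?_, RelIso.ext fun a => Subtype.ext ?_⟩
    · have := hK (γ.symm v)
      rw [γ.apply_symm_apply] at this
      exact this.symm
    · have := hw (γ.symm x)
      rw [γ.apply_symm_apply] at this
      exact this.symm
    · show ((restrictIso γ K hK)⁻¹ a : V) = γ.symm a
      have h1 : (restrictIso γ K hK) ((restrictIso γ K hK)⁻¹ a) = a := RelIso.apply_inv_self _ a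
      have h2 : γ (((restrictIso γ K hK)⁻¹ a : K) : V) = a := congrArg Subtype.val h1
      rw [← h2, γ.symm_apply_apply]

/-- Members of the restricted group, unfolded. [folklore] -/
theorem mem_restrictSubgroup_iff {G : SimpleGraph V} {K : Set V} {o : V}
    {φ : G.induce K ≃g G.induce K} :
    φ ∈ restrictSubgroup G K o ↔ ∃ (γ : G ≃g G) (hK : ∀ v, v ∈ K ↔ γ v ∈ K),
      (∀ x, autWeight G o (γ x) = autWeight G o x) ∧ φ = restrictIso γ K hK :=
  Iff.rfl

/-! ### The component graphs are connected, quasi-transitive and unimodular -/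

section Component

/-- A path of the step graph starting in the component `K` of `y₀` lifts to the induced graph
`G.induce K`. [folklore] -/
theorem induce_levelComponent_reachable {G : SimpleGraph V} (S : Finset V) {y₀ u v : V}
    (hu : u ∈ levelComponent G S y₀) (hv : v ∈ levelComponent G S y₀)
    (huv : (withinGraph G (levelUnion G S)).Reachable u v) :
    (G.induce (levelComponent G S y₀)).Reachable ⟨u, hu⟩ ⟨v, hv⟩ := by
  obtain ⟨w⟩ := huv
  induction w with
  | nil => rfl
  | @cons a b c hadj w ih =>
    have hb : b ∈ levelComponent G S y₀ := SimpleGraph.Reachable.trans hu hadj.reachable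
    have h1 : (G.induce (levelComponent G S y₀)).Adj ⟨a, hu⟩ ⟨b, hb⟩ := hadj.1
    exact h1.reachable.trans (ih hb hv)

/-- **The component graphs are connected.** [folklore] -/
theorem levelComponent_connected {G : SimpleGraph V} (S : Finset V) (y₀ : V) :
    (G.induce (levelComponent G S y₀)).Connected := by
  haveI : Nonempty (levelComponent G S y₀) := ⟨⟨y₀, mem_levelComponent_self G S y₀⟩⟩
  refine SimpleGraph.Connected.mk fun a b => ?_
  have ha : (withinGraph G (levelUnion G S)).Reachable y₀ a := a.2
  have hb : (withinGraph G (levelUnion G S)).Reachable y₀ b := b.2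
  exact induce_levelComponent_reachable S a.2 b.2 (ha.symm.trans hb)

/-- Induced subgraphs of a locally finite graph are locally finite (a `def`, to be introduced
with `haveI` where needed; the same term is a global instance in
`Literature/Probability/Percolation/SlabUniqueness.lean`, not imported here). [folklore] -/
@[reducible] def induceLocallyFinite (G : SimpleGraph V) [G.LocallyFinite] (K : Set V) :
    (G.induce K).LocallyFinite := fun x =>
  (((G.neighborSet x.1).toFinite.preimage Subtype.val_injective.injOn).subset
    fun y (hy : (G.induce K).Adj x y) => by simpa [SimpleGraph.mem_neighborSet] using hy).fintype

variable {G : SimpleGraph V} [G.LocallyFinite] (hconn : G.Connected)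
include hconn

/-- An automorphism of `G` fixing a vertex `a` of the component `K` of `y₀` preserves the weights
and `K`, so it restricts to a member of the restricted group fixing `a`. [folklore] -/
theorem restrictIso_mem_of_apply_eq (S : Finset V) {y₀ : V} {γ : G ≃g G} {a : V}
    (ha : a ∈ levelComponent G S y₀) (hγa : γ a = a) :
    ∃ hK : ∀ v, v ∈ levelComponent G S y₀ ↔ γ v ∈ levelComponent G S y₀,
      (∀ x, autWeight G y₀ (γ x) = autWeight G y₀ x) ∧
        restrictIso γ _ hK ∈ restrictSubgroup G (levelComponent G S y₀) y₀ := by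
  have hw : ∀ x, autWeight G y₀ (γ x) = autWeight G y₀ x :=
    autWeight_map_eq_of_eq G hconn γ y₀ (by rw [hγa])
  have hγy₀ : γ y₀ ∈ levelComponent G S y₀ := by
    -- `γ K(y₀) = K(γ y₀)` and `K(y₀) = K(a) ∋ γ a = a`
    have h1 : γ a ∈ levelComponent G S (γ y₀) := by
      rw [← image_levelComponent G hconn hw S y₀]; exact ⟨a, ha, rfl⟩
    rw [hγa] at h1
    -- `a ∈ K(γ y₀)` gives `K(a) = K(γ y₀)`, and `K(a) = K(y₀)`
    have h2 := levelComponent_eq_of_mem h1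
    rw [levelComponent_eq_of_mem ha] at h2
    rw [h2]; exact mem_levelComponent_self G S _
  have hK := mem_levelComponent_map_iff G hconn hw S hγy₀
  exact ⟨hK, hw, γ, hK, hw, rfl⟩

/-- **The stabiliser orbits of the restricted group are the `S(x)y` of `G`**: for vertices
`a, b` of the component, `S_Γ(a) b` (in `G.induce K`) is carried by the inclusion onto
`S(a) b ⊆ V`. [cite: Timar2006, §2 (levels: |S_x y| = |S_y x| within a level)] -/
theorem image_val_sgStabilizerOrbit (S : Finset V) {y₀ : V} (a b : levelComponent G S y₀) :
    Subtype.val '' sgStabilizerOrbit (restrictSubgroup G (levelComponent G S y₀) y₀) a b =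
      stabilizerOrbit G a b := by
  ext z
  constructor
  · rintro ⟨c, ⟨φ, hφ, hφa, hφb⟩, rfl⟩
    obtain ⟨γ, hK, -, rfl⟩ := hφ
    refine ⟨γ, ?_, ?_⟩
    · exact congrArg Subtype.val hφa
    · exact congrArg Subtype.val hφb
  · rintro ⟨γ, hγa, rfl⟩
    obtain ⟨hK, -, hmem⟩ := restrictIso_mem_of_apply_eq hconn S a.2 hγa
    exact ⟨restrictIso γ _ hK b, ⟨restrictIso γ _ hK, hmem, Subtype.ext hγa, rfl⟩, rfl⟩

/-- Hence `|S_Γ(a) b| = |S(a) b|`. [folklore] -/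
theorem encard_sgStabilizerOrbit_restrictSubgroup (S : Finset V) {y₀ : V}
    (a b : levelComponent G S y₀) :
    (sgStabilizerOrbit (restrictSubgroup G (levelComponent G S y₀) y₀) a b).encard =
      (stabilizerOrbit G a b).encard := by
  rw [← image_val_sgStabilizerOrbit hconn S a b, Subtype.val_injective.encard_image]

/-- Two vertices of the component in a common orbit of the restricted group lie on a common
level of `G`. [folklore] -/
theorem sameLevel_of_mem_sgOrbit_restrictSubgroup (S : Finset V) {y₀ : V}
    {a b : levelComponent G S y₀}
    (h : b ∈ sgOrbit (restrictSubgroup G (levelComponent G S y₀) y₀) a) :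
    SameLevel G (a : V) b := by
  obtain ⟨φ, hφ, hφa⟩ := h
  obtain ⟨γ, hK, hw, rfl⟩ := hφ
  have : (b : V) = γ a := (congrArg Subtype.val hφa).symm
  rw [this]
  exact sameLevel_map_of_autWeight_map_eq G hconn hw a

/-- **The restricted group is unimodular**: `|S_Γ(a) b| = |S_Γ(b) a|` whenever `b ∈ Γ a`
(both equal the `G`-quantities `|S(a)b|`, `|S(b)a|`, which agree on a level by definition).
[cite: Timar2006, §2 (the level-preserving subgroup is unimodular)] -/
theorem restrictSubgroup_unimodular (S : Finset V) {y₀ : V} (a b : levelComponent G S y₀)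
    (h : b ∈ sgOrbit (restrictSubgroup G (levelComponent G S y₀) y₀) a) :
    (sgStabilizerOrbit (restrictSubgroup G (levelComponent G S y₀) y₀) a b).encard =
      (sgStabilizerOrbit (restrictSubgroup G (levelComponent G S y₀) y₀) b a).encard := by
  rw [encard_sgStabilizerOrbit_restrictSubgroup hconn S a b,
    encard_sgStabilizerOrbit_restrictSubgroup hconn S b a]
  exact sameLevel_of_mem_sgOrbit_restrictSubgroup hconn S h

/-- **The restricted group has finitely many orbits** on the component of a vertex `y₀` of the
union, when `G` is transitive: two vertices of the component on a common level of `G` are in a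
common orbit (a transporting automorphism of `G` preserves the weights and the component), so a
choice of one vertex of the component on each of the finitely many levels meets every orbit.
[cite: Timar2006, §2 (the level-preserving subgroup is quasi-transitive on a finite union of levels)] -/
theorem exists_finset_sgOrbit_restrictSubgroup (ht : IsGraphTransitive G) (S : Finset V) {y₀ : V}
    (hy₀ : y₀ ∈ levelUnion G S) :
    ∃ R : Finset (levelComponent G S y₀), ∀ a : levelComponent G S y₀,
      ∃ r ∈ R, a ∈ sgOrbit (restrictSubgroup G (levelComponent G S y₀) y₀) r := by
  classical
  set K := levelComponent G S y₀ with hKdef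
  -- one representative per level of `S` met by `K`
  let rep : V → K := fun s =>
    if h : ∃ v ∈ K, SameLevel G s v then ⟨h.choose, h.choose_spec.1⟩
    else ⟨y₀, mem_levelComponent_self G S y₀⟩
  refine ⟨S.image rep, fun a => ?_⟩
  obtain ⟨s, hs, hsa⟩ := mem_levelUnion_iff.1 (levelComponent_subset_levelUnion hy₀ a.2)
  have hex : ∃ v ∈ K, SameLevel G s v := ⟨a, a.2, hsa⟩
  have hrep : (rep s : V) = hex.choose := by
    show ((if h : ∃ v ∈ K, SameLevel G s v then (⟨h.choose, h.choose_spec.1⟩ : K)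
      else ⟨y₀, mem_levelComponent_self G S y₀⟩ : K) : V) = hex.choose
    rw [dif_pos hex]
  have hlev : SameLevel G (rep s : V) a := by
    rw [hrep]; exact (hex.choose_spec.2).symm.trans hconn hsa
  refine ⟨rep s, Finset.mem_image_of_mem rep hs, ?_⟩
  -- transport `rep s ↦ a` inside `G`; the automorphism preserves weights and `K`
  obtain ⟨γ, hγ⟩ := ht (rep s : V) a
  have hw : ∀ x, autWeight G y₀ (γ x) = autWeight G y₀ x :=
    autWeight_map_eq_of_sameLevel G hconn γ y₀ (by rw [hγ]; exact hlev)
  have hγy₀ : γ y₀ ∈ K := by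
    have h1 : γ (rep s : V) ∈ levelComponent G S (γ y₀) := by
      rw [← image_levelComponent G hconn hw S y₀]; exact ⟨rep s, (rep s).2, rfl⟩
    rw [hγ] at h1
    have h2 := levelComponent_eq_of_mem h1
    rw [levelComponent_eq_of_mem a.2] at h2
    rw [hKdef, h2]; exact mem_levelComponent_self G S _
  have hK := mem_levelComponent_map_iff G hconn hw S hγy₀
  exact ⟨restrictIso γ K hK, ⟨γ, hK, hw, rfl⟩, Subtype.ext hγ⟩

/-- **The component graphs are quasi-transitive** (full automorphism group of `G.induce K`),
for `G` connected, locally finite and transitive. [cite: Timar2006, §2 (quasi-transitivity of the restricted action)]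
[cite: LyonsPeres2016, §8.2 (Exercise 8.8)] -/
theorem levelComponent_isQuasiTransitive (ht : IsGraphTransitive G) (S : Finset V) {y₀ : V}
    (hy₀ : y₀ ∈ levelUnion G S) : IsQuasiTransitive (G.induce (levelComponent G S y₀)) := by
  obtain ⟨R, hR⟩ := exists_finset_sgOrbit_restrictSubgroup hconn ht S hy₀
  exact isQuasiTransitive_of_subgroup _ R hR

/-- **The component graphs are unimodular** (full automorphism group of `G.induce K`), for `G`
connected, locally finite and transitive: the restricted group is quasi-transitive and
unimodular, and Lyons–Peres 2016, Exercise 8.8 (`isGraphUnimodular_of_subgroup`) applies.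
[cite: Timar2006, §2 (unimodularity of the restricted action) and proof of Cor. 5.7]
[cite: LyonsPeres2016, §8.2 (Exercise 8.8)] -/
theorem levelComponent_isGraphUnimodular (ht : IsGraphTransitive G) (S : Finset V) {y₀ : V}
    (hy₀ : y₀ ∈ levelUnion G S) : IsGraphUnimodular (G.induce (levelComponent G S y₀)) := by
  haveI := induceLocallyFinite G (levelComponent G S y₀)
  obtain ⟨R, hR⟩ := exists_finset_sgOrbit_restrictSubgroup hconn ht S hy₀
  exact isGraphUnimodular_of_subgroup _ (levelComponent_connected S y₀) R hR
    fun a b hab => restrictSubgroup_unimodular hconn S a b hab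

end Component

end Literature.Barriers.CriticalPhenomena

end
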